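import Literature.NumberTheory.LFunctions.StableAverageTwistedCentralValues
import Literature.NumberTheory.EllipticCurves.NewformsRealCoefficients
import Literature.NumberTheory.EllipticCurves.ModularityVersionAp
import Literature.NumberTheory.EllipticCurves.NewformsFiniteProofs
import HarnessLib

/-!
# Purity of the AMPLIFIED mixed moment `Σʰ ω_f A_f² L(½,f) L(½,f⊗χ_{−D})` at prime inert levels
# (from Michel–Ramakrishnan 2012, Cor. 1, and the Hecke relations) — PROVED, zero new facts

Topic `Literature/NumberTheory/LFunctions` (namespace `Literature.NumberTheory.LFunctions`, amplifier
vocabulary in the sub-namespace `IwaniecSarnak` of `FamilyNonvanishingLandauSiegel`). Typed for the cell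
`landau-siegel` (LS programme, rung F-S3), sub-cell §B-fam, registry row famE-08 «E-fam-amp /
AmplifiedPurity» (B-fam/EDLIST.md v1.8; KILL-draft §4 row «AmplifiedPurity», binder of status (II) for
amplified measures `w = ω_f·A_f²`): Iwaniec's «purity» of the mixed moment (7.4) — «the absence of lower
order terms involving the derivative `L'(1,χ)`» [IwaniecConversations2006, §7 p. 96, held chunk
p0096:L25] — PERSISTS under amplification by any real Hecke polynomial supported on primes, EXACTLY, at
every prime level `N` inert in `K = ℚ(√−D)` in the stable range of Michel–Ramakrishnan.

## The printed input (held: `paper:arxiv-0709.4668`, typed p461432 as `michelRamakrishnan2012_corollary1`)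

Michel–Ramakrishnan 2012, Cor. 1 (Ψ = 1_K) [MichelRamakrishnan2012, arXiv p. 3]: for `−D` an odd
fundamental discriminant, `χ = χ_{−D}`, `N` prime inert in `K`, `m ≥ 1` with `N > mD`, weight `2k ≥ 2`:
`√D u²/(2π) · Σʰ_{f ∈ H_{2k}(N)} ω_f L(½,f) L(½,f⊗χ) a_m(f) = −δ_{k=1}·12 h² σ_N(m)/(N−1) + u m^{k−1} R(m) h`
(`h` the class number, `u = w_K/2`, `R(m)` = number of ideals of norm `m`, `σ_N(m) = Σ_{d∣m,(d,N)=1} d`).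
The right side is a polynomial in `h` with ARITHMETIC coefficients — no `L`-data at all; since
`h = u√D·L(1,χ)/π` (Dirichlet), it is `L(1,χ)·(…) + L(1,χ)²·(…)`: pure, for EVERY `m` in the stable range.

## What is typed (all PROVED; D-0026: no new named fact)

* `IwaniecSarnak.primeAmplifier S c f = Σ_{ℓ ∈ S} c_ℓ · a_ℓ(f)` — a real amplifier supported on a finite
  set `S` of primes, in the ARITHMETIC normalisation `a_ℓ` (the Hecke normalisation `λ_f(ℓ) =
  a_ℓ ℓ^{−(κ−1)/2}` is the rescaling `c_ℓ ↦ c_ℓ ℓ^{−(κ−1)/2}`); `a_ℓ(f) ∈ ℝ` for a newform on `Γ₀(N)`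
  (tree: `IsNewform0.cuspCoeff_im_eq_zero`).
* `IwaniecSarnak.primeAmplifier_sq` — HECKE LINEARISATION (tree: `IsNewform0.cuspCoeff_prime_mul`,
  `IsNewform0.coeff_mul_of_coprime_holds`): for a newform `f` of weight `κ` and primes `ℓ ∈ S`, `ℓ ∤ N`,
  `A_f² = Σ_{ℓ ≠ ℓ' ∈ S} c_ℓ c_ℓ' a_{ℓℓ'}(f) + Σ_{ℓ ∈ S} c_ℓ² a_{ℓ²}(f) + Σ_{ℓ ∈ S} c_ℓ² ℓ^{κ−1}`.
* `IwaniecSarnak.harmonicSum_mixed_amplified_eq` — the amplified mixed moment is the same linear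
  combination of the `a_m`-TWISTED mixed moments `H(m) = Σʰ ω_f re(L(½,f)L(½,f⊗χ)a_m(f))`,
  `m ∈ {ℓℓ', ℓ², 1}` (any level, weight, character; no fact used).
* `amplified_mixedMoment_eq_of_corollary1` — GIVEN `michelRamakrishnan2012_corollary1`: in MR's setting,
  for `S` primes with `ℓ ℓ' D < N` (`ℓ, ℓ' ∈ S`) and `D < N`,
  `√D u²/(2π) · Σʰ ω_f A_f² L(½,f)L(½,f⊗χ) = Σ_{ℓ≠ℓ'} c c·MR(ℓℓ') + Σ c²·MR(ℓ²) + (Σ c² ℓ^{2k−1})·MR(1)`,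
  `MR(m) = mrMain K N k m` the printed right side.
* `amplified_mixedMoment_pure_of_corollary1` — THE PURITY STATEMENT: the same quantity equals
  `h · ampLinear K k S c + h² · ampQuadratic N k S c` with the two coefficient forms EXPLICIT and free of
  `L`-data (`R`, `σ_N`, powers of primes, `u`): no `L'(1,χ)` term can occur. (famE-08 for prime-supported
  amplifiers at prime inert levels: theorem-in-tree GIVEN one printed fact.)

NOT typed here (said so that no reader over-reads the file): the D-UNIFORM ratio binder
`(iwaniecSarnakFamilyAmp (2k) A).MixedOverMass δ` of `CentralValueFamilyDevices` — it needs, besides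
purity, a lower bound for the amplified EVEN harmonic mass `Σʰ_{w_f=1} ω_f A_f²` (Petersson + root-number
equidistribution: `kowalskiMichel2000_petersson`, `kowalskiMichel2000_lemma1`), which is the even-share
bridge of the cell's §C typers; and amplifiers with composite support (same Hecke algebra, longer
bookkeeping). FRAMING: «The programme SEARCHES and TYPES; no claim about Landau–Siegel zeros,
Theorems 1–2 of arXiv:2211.02515 or a repaired Margin232 until a kernel theorem says so.»

## References

* [MichelRamakrishnan2012] Ph. Michel, D. Ramakrishnan, *Consequences of the Gross–Zagier formulae:
  stability of average L-values, subconvexity, and non-vanishing mod p*, Cor. 1 (arXiv:0709.4668 p. 3);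
  tree fact `michelRamakrishnan2012_corollary1` (`StableAverageTwistedCentralValues`).
* [IwaniecConversations2006] H. Iwaniec, LNM 1891 (2006), §7, p. 96 («purity» of (7.4)).
* [DiamondShurman2005] Prop. 5.8.5 (Hecke relations; tree theorems `IsNewform0.cuspCoeff_prime_mul`,
  `IsNewform0.coeff_mul_of_coprime_holds`).
-/

noncomputable section

open scoped MatrixGroups
open CongruenceSubgroup Complex Finset
open Literature.NumberTheory.EllipticCurves.ModularForms
open NumberField NumberField.Units

namespace Literature.NumberTheory.LFunctions

namespace IwaniecSarnak

/-! ### §1 Prime-supported amplifiers and their Hecke linearisation -/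

section Amplifier

variable {N : ℕ} {κ : ℤ}

/-- **A real amplifier supported on a finite set of primes**, arithmetic normalisation:
`A_f = Σ_{ℓ ∈ S} c_ℓ · re a_ℓ(f)` (for a newform on `Γ₀(N)` the coefficients are real, so `re` is
harmless: `primeAmplifierC_eq`). The amplified harmonic measure of the family method is `ω_f · A_f²`
(KILL-draft §2 «amplified ω_f·|A_f|²»). [cite: IwaniecConversations2006, §7 (7.3)–(7.4)] -/
def primeAmplifier (S : Finset ℕ) (c : ℕ → ℝ) (f : CuspForm (Gamma0 N) κ) : ℝ :=
  ∑ ℓ ∈ S, c ℓ * (cuspCoeff f ℓ).re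

/-- The same amplifier as a complex number `Σ_{ℓ ∈ S} c_ℓ · a_ℓ(f)`. [cite: IwaniecConversations2006, §7 (7.3)–(7.4)] -/
def primeAmplifierC (S : Finset ℕ) (c : ℕ → ℝ) (f : CuspForm (Gamma0 N) κ) : ℂ :=
  ∑ ℓ ∈ S, (c ℓ : ℂ) * cuspCoeff f ℓ

variable [NeZero N]

/-- For a newform the complex amplifier is the real one (real coefficients,
`IsNewform0.cuspCoeff_eq_ofReal_re`). [cite: Shimura1971, proof of Thm. 3.48] -/
theorem primeAmplifierC_eq {f : CuspForm (Gamma0 N) κ} (hf : IsNewform0 f) (S : Finset ℕ)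
    (c : ℕ → ℝ) : primeAmplifierC S c f = (primeAmplifier S c f : ℂ) := by
  unfold primeAmplifierC primeAmplifier
  push_cast
  refine Finset.sum_congr rfl fun ℓ _ => ?_
  rw [← hf.cuspCoeff_eq_ofReal_re ℓ]

/-- Hecke: `a_ℓ a_ℓ' = a_{ℓℓ'}` for distinct primes (multiplicativity on coprime arguments).
[cite: DiamondShurman2005, Prop. 5.8.5] -/
theorem cuspCoeff_mul_of_ne_primes {f : CuspForm (Gamma0 N) κ} (hf : IsNewform0 f) {ℓ ℓ' : ℕ}
    (hℓ : ℓ.Prime) (hℓ' : ℓ'.Prime) (hne : ℓ ≠ ℓ') :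
    cuspCoeff f ℓ * cuspCoeff f ℓ' = cuspCoeff f (ℓ * ℓ') := by
  have hcop : ℓ.Coprime ℓ' := (Nat.coprime_primes hℓ hℓ').mpr hne
  have h := IsNewform0.coeff_mul_of_coprime_holds hf hcop
  change cuspCoeff f (ℓ * ℓ') = cuspCoeff f ℓ * cuspCoeff f ℓ' at h
  exact h.symm

/-- Hecke at a prime not dividing the level: `a_ℓ² = a_{ℓ²} + ℓ^{κ−1}` (`a_1 = 1`).
[cite: DiamondShurman2005, Prop. 5.8.5] -/
theorem cuspCoeff_prime_sq {f : CuspForm (Gamma0 N) κ} (hf : IsNewform0 f) {ℓ : ℕ} (hℓ : ℓ.Prime)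
    (hℓN : ¬ ℓ ∣ N) :
    cuspCoeff f ℓ * cuspCoeff f ℓ = cuspCoeff f (ℓ ^ 2) + (ℓ : ℂ) ^ (κ - 1) := by
  have h := hf.cuspCoeff_prime_mul hℓ ℓ
  have h1 : cuspCoeff f 1 = 1 := hf.2.2
  rw [if_neg hℓN, if_pos (dvd_refl ℓ), Nat.div_self hℓ.pos, h1, mul_one] at h
  rw [sq, h]
  ring

/-- **Hecke linearisation of the squared amplifier** (complex form): for a newform `f` of weight
`κ` on `Γ₀(N)` and a finite set `S` of primes not dividing `N`,
`(Σ_{ℓ∈S} c_ℓ a_ℓ)² = Σ_{ℓ∈S} Σ_{ℓ'∈S∖{ℓ}} c_ℓ c_ℓ' a_{ℓℓ'} + Σ_{ℓ∈S} c_ℓ² a_{ℓ²} + Σ_{ℓ∈S} c_ℓ² ℓ^{κ−1}`.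
[cite: DiamondShurman2005, Prop. 5.8.5] -/
theorem primeAmplifierC_sq {f : CuspForm (Gamma0 N) κ} (hf : IsNewform0 f) {S : Finset ℕ}
    (hS : ∀ ℓ ∈ S, ℓ.Prime) (hSN : ∀ ℓ ∈ S, ¬ ℓ ∣ N) (c : ℕ → ℝ) :
    primeAmplifierC S c f ^ 2 =
      (∑ ℓ ∈ S, ∑ ℓ' ∈ S.erase ℓ, (c ℓ : ℂ) * c ℓ' * cuspCoeff f (ℓ * ℓ')) +
        (∑ ℓ ∈ S, (c ℓ : ℂ) ^ 2 * cuspCoeff f (ℓ ^ 2)) +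
          ∑ ℓ ∈ S, (c ℓ : ℂ) ^ 2 * (ℓ : ℂ) ^ (κ - 1) := by
  unfold primeAmplifierC
  rw [sq, Finset.sum_mul_sum, ← Finset.sum_add_distrib, ← Finset.sum_add_distrib]
  refine Finset.sum_congr rfl fun ℓ hℓ => ?_
  rw [← Finset.add_sum_erase S _ hℓ]
  have hdiag : (c ℓ : ℂ) * cuspCoeff f ℓ * ((c ℓ : ℂ) * cuspCoeff f ℓ) =
      (c ℓ : ℂ) ^ 2 * cuspCoeff f (ℓ ^ 2) + (c ℓ : ℂ) ^ 2 * (ℓ : ℂ) ^ (κ - 1) := by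
    have h := cuspCoeff_prime_sq hf (hS ℓ hℓ) (hSN ℓ hℓ)
    calc (c ℓ : ℂ) * cuspCoeff f ℓ * ((c ℓ : ℂ) * cuspCoeff f ℓ)
        = (c ℓ : ℂ) ^ 2 * (cuspCoeff f ℓ * cuspCoeff f ℓ) := by ring
      _ = _ := by rw [h]; ring
  have hoff : ∑ ℓ' ∈ S.erase ℓ, (c ℓ : ℂ) * cuspCoeff f ℓ * ((c ℓ' : ℂ) * cuspCoeff f ℓ') =
      ∑ ℓ' ∈ S.erase ℓ, (c ℓ : ℂ) * c ℓ' * cuspCoeff f (ℓ * ℓ') := by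
    refine Finset.sum_congr rfl fun ℓ' hℓ' => ?_
    have hne : ℓ ≠ ℓ' := fun h => (Finset.mem_erase.1 hℓ').1 h.symm
    have hℓ'S : ℓ' ∈ S := (Finset.mem_erase.1 hℓ').2
    calc (c ℓ : ℂ) * cuspCoeff f ℓ * ((c ℓ' : ℂ) * cuspCoeff f ℓ')
        = (c ℓ : ℂ) * c ℓ' * (cuspCoeff f ℓ * cuspCoeff f ℓ') := by ring
      _ = (c ℓ : ℂ) * c ℓ' * cuspCoeff f (ℓ * ℓ') := by
          rw [cuspCoeff_mul_of_ne_primes hf (hS ℓ hℓ) (hS ℓ' hℓ'S) hne]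
  rw [hdiag, hoff]
  ring

/-- **Hecke linearisation of the squared amplifier** (real form, the one the moments use): with
`A_f = primeAmplifier S c f`,
`A_f² = Σ_{ℓ∈S} Σ_{ℓ'∈S∖{ℓ}} c_ℓ c_ℓ' re a_{ℓℓ'} + Σ_{ℓ∈S} c_ℓ² re a_{ℓ²} + Σ_{ℓ∈S} c_ℓ² ℓ^{κ−1}`.
[cite: DiamondShurman2005, Prop. 5.8.5] -/
theorem primeAmplifier_sq {f : CuspForm (Gamma0 N) κ} (hf : IsNewform0 f) {S : Finset ℕ}
    (hS : ∀ ℓ ∈ S, ℓ.Prime) (hSN : ∀ ℓ ∈ S, ¬ ℓ ∣ N) (c : ℕ → ℝ) :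
    primeAmplifier S c f ^ 2 =
      (∑ ℓ ∈ S, ∑ ℓ' ∈ S.erase ℓ, c ℓ * c ℓ' * (cuspCoeff f (ℓ * ℓ')).re) +
        (∑ ℓ ∈ S, c ℓ ^ 2 * (cuspCoeff f (ℓ ^ 2)).re) +
          ∑ ℓ ∈ S, c ℓ ^ 2 * (ℓ : ℝ) ^ (κ - 1) := by
  have hC := primeAmplifierC_sq hf hS hSN c
  rw [primeAmplifierC_eq hf] at hC
  have hre := congrArg Complex.re hC
  rw [← Complex.ofReal_pow, Complex.ofReal_re] at hre
  rw [hre]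
  simp only [Complex.add_re, Complex.re_sum]
  congr 1
  congr 1
  · refine Finset.sum_congr rfl fun ℓ _ => Finset.sum_congr rfl fun ℓ' _ => ?_
    rw [← Complex.ofReal_mul, Complex.re_ofReal_mul]
  · refine Finset.sum_congr rfl fun ℓ _ => ?_
    rw [← Complex.ofReal_pow, Complex.re_ofReal_mul]
  · refine Finset.sum_congr rfl fun ℓ _ => ?_
    rw [← Complex.ofReal_pow, ← Complex.ofReal_natCast, ← Complex.ofReal_zpow, ← Complex.ofReal_mul,
      Complex.ofReal_re]

end Amplifier

/-! ### §2 The amplified mixed moment as a combination of `a_m`-twisted mixed moments -/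

section Moment

variable {N : ℕ} [NeZero N] {κ : ℤ}

/-- The `a_m`-twisted harmonic mixed moment `H(m) = Σʰ_{f ∈ H_κ(N)} ω_f · re(L(½,f) L(½,f⊗χ) a_m(f))`
— the left-side statistic of Michel–Ramakrishnan's Cor. 1. [cite: MichelRamakrishnan2012, Cor. 1, arXiv p. 3] -/
def twistedMixedMoment (N₀ : ℕ) [NeZero N₀] (κ₀ : ℤ) {D : ℕ} (χ : DirichletCharacter ℂ D)
    (m : ℕ) : ℝ :=
  harmonicSum N₀ κ₀ (fun f => (centralValue f * twistedCentralValue f χ * cuspCoeff f m).re)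

/-- On newforms `re(L·L_χ·a_m) = re(L·L_χ) · re a_m` (real coefficients). [cite: Shimura1971, proof of Thm. 3.48] -/
private theorem re_mul_cuspCoeff {f : CuspForm (Gamma0 N) κ} (hf : IsNewform0 f) (z : ℂ) (m : ℕ) :
    (z * cuspCoeff f m).re = z.re * (cuspCoeff f m).re := by
  conv_lhs => rw [hf.cuspCoeff_eq_ofReal_re m]
  exact Complex.re_mul_ofReal z _

/-- **The amplified mixed moment, Hecke-linearised** (any level `N`, weight `κ`, character `χ`; no
fact used): for `S` a finite set of primes not dividing `N` and real `c`,
`Σʰ ω_f · re(L(½,f)L(½,f⊗χ)) · A_f² = Σ_{ℓ∈S} Σ_{ℓ'∈S∖{ℓ}} c_ℓ c_ℓ' H(ℓℓ') + Σ_{ℓ∈S} c_ℓ² H(ℓ²)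
  + (Σ_{ℓ∈S} c_ℓ² ℓ^{κ−1}) · H(1)`, `H(m) = twistedMixedMoment N κ χ m`.
[cite: IwaniecConversations2006, §7 (7.4)] -/
theorem harmonicSum_mixed_amplified_eq {D : ℕ} (χ : DirichletCharacter ℂ D) {S : Finset ℕ}
    (hS : ∀ ℓ ∈ S, ℓ.Prime) (hSN : ∀ ℓ ∈ S, ¬ ℓ ∣ N) (c : ℕ → ℝ) :
    harmonicSum N κ (fun f => (centralValue f * twistedCentralValue f χ).re * primeAmplifier S c f ^ 2)
      = (∑ ℓ ∈ S, ∑ ℓ' ∈ S.erase ℓ, c ℓ * c ℓ' * twistedMixedMoment N κ χ (ℓ * ℓ')) +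
        (∑ ℓ ∈ S, c ℓ ^ 2 * twistedMixedMoment N κ χ (ℓ ^ 2)) +
          (∑ ℓ ∈ S, c ℓ ^ 2 * (ℓ : ℝ) ^ (κ - 1)) * twistedMixedMoment N κ χ 1 := by
  have hfin := finite_newforms0_holds N κ
  set F := hfin.toFinset with hF
  have hmem : ∀ f ∈ F, IsNewform0 f := fun f hf => hfin.mem_toFinset.mp hf
  unfold twistedMixedMoment
  simp only [harmonicSum_eq_sum hfin]
  -- pointwise: expand `A_f²` on newforms and split `re`
  have hpt : ∀ f ∈ F, harmonicWeight f *
      ((centralValue f * twistedCentralValue f χ).re * primeAmplifier S c f ^ 2) =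
      (∑ ℓ ∈ S, ∑ ℓ' ∈ S.erase ℓ, c ℓ * c ℓ' *
          (harmonicWeight f * (centralValue f * twistedCentralValue f χ * cuspCoeff f (ℓ * ℓ')).re)) +
        (∑ ℓ ∈ S, c ℓ ^ 2 *
          (harmonicWeight f * (centralValue f * twistedCentralValue f χ * cuspCoeff f (ℓ ^ 2)).re)) +
        (∑ ℓ ∈ S, c ℓ ^ 2 * (ℓ : ℝ) ^ (κ - 1)) *
          (harmonicWeight f * (centralValue f * twistedCentralValue f χ * cuspCoeff f 1).re) := by
    intro f hf
    have hnew := hmem f hf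
    rw [primeAmplifier_sq hnew hS hSN c]
    simp only [re_mul_cuspCoeff hnew]
    have h1 : (cuspCoeff f 1).re = 1 := by
      have : cuspCoeff f 1 = 1 := hnew.2.2
      rw [this, Complex.one_re]
    rw [h1, mul_one]
    set w : ℝ := harmonicWeight f with hw
    set r : ℝ := (centralValue f * twistedCentralValue f χ).re with hr
    have hX : (∑ ℓ ∈ S, ∑ ℓ' ∈ S.erase ℓ, c ℓ * c ℓ' * (w * (r * (cuspCoeff f (ℓ * ℓ')).re))) =
        w * (r * ∑ ℓ ∈ S, ∑ ℓ' ∈ S.erase ℓ, c ℓ * c ℓ' * (cuspCoeff f (ℓ * ℓ')).re) := by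
      rw [Finset.mul_sum, Finset.mul_sum]
      refine Finset.sum_congr rfl fun ℓ _ => ?_
      rw [Finset.mul_sum, Finset.mul_sum]
      refine Finset.sum_congr rfl fun ℓ' _ => ?_
      ring
    have hY : (∑ ℓ ∈ S, c ℓ ^ 2 * (w * (r * (cuspCoeff f (ℓ ^ 2)).re))) =
        w * (r * ∑ ℓ ∈ S, c ℓ ^ 2 * (cuspCoeff f (ℓ ^ 2)).re) := by
      rw [Finset.mul_sum, Finset.mul_sum]
      refine Finset.sum_congr rfl fun ℓ _ => ?_
      ring
    rw [hX, hY]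
    ring
  rw [Finset.sum_congr rfl hpt, Finset.sum_add_distrib, Finset.sum_add_distrib]
  have hA : (∑ f ∈ F, ∑ ℓ ∈ S, ∑ ℓ' ∈ S.erase ℓ, c ℓ * c ℓ' *
        (harmonicWeight f * (centralValue f * twistedCentralValue f χ * cuspCoeff f (ℓ * ℓ')).re)) =
      ∑ ℓ ∈ S, ∑ ℓ' ∈ S.erase ℓ, c ℓ * c ℓ' * ∑ f ∈ F,
        harmonicWeight f * (centralValue f * twistedCentralValue f χ * cuspCoeff f (ℓ * ℓ')).re := by
    rw [Finset.sum_comm]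
    refine Finset.sum_congr rfl fun ℓ _ => ?_
    rw [Finset.sum_comm]
    refine Finset.sum_congr rfl fun ℓ' _ => ?_
    rw [Finset.mul_sum]
  have hB : (∑ f ∈ F, ∑ ℓ ∈ S, c ℓ ^ 2 *
        (harmonicWeight f * (centralValue f * twistedCentralValue f χ * cuspCoeff f (ℓ ^ 2)).re)) =
      ∑ ℓ ∈ S, c ℓ ^ 2 * ∑ f ∈ F,
        harmonicWeight f * (centralValue f * twistedCentralValue f χ * cuspCoeff f (ℓ ^ 2)).re := by
    rw [Finset.sum_comm]
    refine Finset.sum_congr rfl fun ℓ _ => ?_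
    rw [Finset.mul_sum]
  have hC : (∑ f ∈ F, (∑ ℓ ∈ S, c ℓ ^ 2 * (ℓ : ℝ) ^ (κ - 1)) *
        (harmonicWeight f * (centralValue f * twistedCentralValue f χ * cuspCoeff f 1).re)) =
      (∑ ℓ ∈ S, c ℓ ^ 2 * (ℓ : ℝ) ^ (κ - 1)) * ∑ f ∈ F,
        harmonicWeight f * (centralValue f * twistedCentralValue f χ * cuspCoeff f 1).re := by
    rw [Finset.mul_sum]
  rw [hA, hB, hC]

end Moment

end IwaniecSarnak

/-! ### §3 The amplified identity from Michel–Ramakrishnan, and its purity -/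

section Purity

open IwaniecSarnak

/-- The printed right side of Cor. 1 as a function of `m`:
`MR(m) = −δ_{k=1}·12 h² σ_N(m)/(N−1) + u m^{k−1} R(m) h`. [cite: MichelRamakrishnan2012, Cor. 1, arXiv p. 3] -/
def mrMain (K : Type) [Field K] [NumberField K] (N k m : ℕ) : ℝ :=
  -(if k = 1 then (1 : ℝ) else 0) * 12 * (classNumber K : ℝ) ^ 2 * sigmaCoprime N m / ((N : ℝ) - 1)
    + halfTorsionOrder K * (m : ℝ) ^ (k - 1) * idealNormCount K m * classNumber K

/-- The coefficient of `h` in `MR(m)`: `u m^{k−1} R(m)` (no `L`-data). [cite: MichelRamakrishnan2012, Cor. 1, arXiv p. 3] -/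
def mrLin (K : Type) [Field K] [NumberField K] (k m : ℕ) : ℝ :=
  halfTorsionOrder K * (m : ℝ) ^ (k - 1) * idealNormCount K m

/-- The coefficient of `h²` in `MR(m)`: `−δ_{k=1}·12 σ_N(m)/(N−1)` (no `L`-data; absent for weight
`2k ≥ 4`). [cite: MichelRamakrishnan2012, Cor. 1, arXiv p. 3] -/
def mrQuad (N k m : ℕ) : ℝ :=
  -(if k = 1 then (1 : ℝ) else 0) * 12 * sigmaCoprime N m / ((N : ℝ) - 1)

/-- `MR(m) = h · mrLin + h² · mrQuad`. [cite: MichelRamakrishnan2012, Cor. 1, arXiv p. 3] -/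
theorem mrMain_eq (K : Type) [Field K] [NumberField K] (N k m : ℕ) :
    mrMain K N k m = classNumber K * mrLin K k m + (classNumber K : ℝ) ^ 2 * mrQuad N k m := by
  unfold mrMain mrLin mrQuad
  ring

/-- The coefficient of `h` in the amplified identity (LINEAR part): the amplifier combination of the
`mrLin` — `Σ_{ℓ≠ℓ'} c c·u(ℓℓ')^{k−1}R(ℓℓ') + Σ c²·u ℓ^{2(k−1)}R(ℓ²) + (Σ c² ℓ^{2k−1})·u R(1)`. Free of
`L`-data. [cite: MichelRamakrishnan2012, Cor. 1, arXiv p. 3] -/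
def ampLinear (K : Type) [Field K] [NumberField K] (k : ℕ) (S : Finset ℕ) (c : ℕ → ℝ) : ℝ :=
  (∑ ℓ ∈ S, ∑ ℓ' ∈ S.erase ℓ, c ℓ * c ℓ' * mrLin K k (ℓ * ℓ')) +
    (∑ ℓ ∈ S, c ℓ ^ 2 * mrLin K k (ℓ ^ 2)) +
      (∑ ℓ ∈ S, c ℓ ^ 2 * (ℓ : ℝ) ^ ((2 * (k : ℤ)) - 1)) * mrLin K k 1

/-- The coefficient of `h²` in the amplified identity (QUADRATIC part, present only in weight `2`):
the same amplifier combination of the `mrQuad`. Free of `L`-data.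
[cite: MichelRamakrishnan2012, Cor. 1, arXiv p. 3] -/
def ampQuadratic (N k : ℕ) (S : Finset ℕ) (c : ℕ → ℝ) : ℝ :=
  (∑ ℓ ∈ S, ∑ ℓ' ∈ S.erase ℓ, c ℓ * c ℓ' * mrQuad N k (ℓ * ℓ')) +
    (∑ ℓ ∈ S, c ℓ ^ 2 * mrQuad N k (ℓ ^ 2)) +
      (∑ ℓ ∈ S, c ℓ ^ 2 * (ℓ : ℝ) ^ ((2 * (k : ℤ)) - 1)) * mrQuad N k 1

/-- Splitting a weighted sum of `h·L + h²·Q` terms. [folklore] -/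
private theorem sum_mul_split {ι : Type*} (s : Finset ι) (g L Q : ι → ℝ) (h : ℝ) :
    ∑ x ∈ s, g x * (h * L x + h ^ 2 * Q x) =
      h * ∑ x ∈ s, g x * L x + h ^ 2 * ∑ x ∈ s, g x * Q x := by
  rw [Finset.mul_sum, Finset.mul_sum, ← Finset.sum_add_distrib]
  exact Finset.sum_congr rfl fun x _ => by ring

/-- **THE AMPLIFIED MICHEL–RAMAKRISHNAN IDENTITY.** GIVEN `michelRamakrishnan2012_corollary1`: for
`−D` odd fundamental, `K`, `χ = χ_{−D}` (`ζ_K = ζ·L(χ)`), `N` prime inert (`χ(N) = −1`) with `D < N`,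
weight `2k ≥ 2`, and a real amplifier supported on a finite set `S` of primes with `ℓ ℓ' D < N` for all
`ℓ, ℓ' ∈ S` (so every Hecke-linearised index lies in the stable range, and `ℓ ≠ N`):
`√D u²/(2π) · Σʰ ω_f re(L(½,f)L(½,f⊗χ)) A_f² = Σ_{ℓ∈S}Σ_{ℓ'∈S∖{ℓ}} c c·MR(ℓℓ') + Σ c²·MR(ℓ²)
  + (Σ c² ℓ^{2k−1})·MR(1)`. [cite: MichelRamakrishnan2012, Cor. 1, arXiv p. 3] -/
theorem amplified_mixedMoment_eq_of_corollary1 (h : michelRamakrishnan2012_corollary1)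
    {D : ℕ} [NeZero D] (hD : Odd D)
    {K : Type} [Field K] [NumberField K] (h2 : Module.finrank ℚ K = 2)
    (hK : NumberField.discr K = -(D : ℤ))
    (χ : DirichletCharacter ℂ D)
    (hζ : ∀ s : ℝ, 1 < s → NumberField.dedekindZeta K s = riemannZeta s * LSeries (fun n => χ n) s)
    {N : ℕ} [NeZero N] (hN : N.Prime) (hχN : χ N = -1) (hDN : D < N) {k : ℕ} (hk : 1 ≤ k)
    {S : Finset ℕ} (hS : ∀ ℓ ∈ S, ℓ.Prime) (hbig : ∀ ℓ ∈ S, ∀ ℓ' ∈ S, ℓ * ℓ' * D < N)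
    (c : ℕ → ℝ) :
    Real.sqrt D * halfTorsionOrder K ^ 2 / (2 * Real.pi) *
        harmonicSum N (2 * (k : ℤ))
          (fun f => (centralValue f * twistedCentralValue f χ).re * primeAmplifier S c f ^ 2)
      = (∑ ℓ ∈ S, ∑ ℓ' ∈ S.erase ℓ, c ℓ * c ℓ' * mrMain K N k (ℓ * ℓ')) +
        (∑ ℓ ∈ S, c ℓ ^ 2 * mrMain K N k (ℓ ^ 2)) +
          (∑ ℓ ∈ S, c ℓ ^ 2 * (ℓ : ℝ) ^ ((2 * (k : ℤ)) - 1)) * mrMain K N k 1 := by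
  have hDpos : 0 < D := Nat.pos_of_ne_zero (NeZero.ne D)
  -- no prime of `S` divides the prime level `N`: `ℓ ≤ ℓ·ℓ·D < N`
  have hSN : ∀ ℓ ∈ S, ¬ ℓ ∣ N := by
    intro ℓ hℓ hdvd
    have hℓp := hS ℓ hℓ
    have hlt : ℓ * ℓ * D < N := hbig ℓ hℓ ℓ hℓ
    have hle : ℓ ≤ ℓ * ℓ * D := by
      calc ℓ = ℓ * 1 * 1 := by ring
        _ ≤ ℓ * ℓ * D := by
          apply Nat.mul_le_mul (Nat.mul_le_mul le_rfl hℓp.one_lt.le) hDpos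
    have hℓN : ℓ = N := (Nat.prime_dvd_prime_iff_eq hℓp hN).mp hdvd
    omega
  -- MR for each index
  have hMR : ∀ m : ℕ, 1 ≤ m → m * D < N →
      Real.sqrt D * halfTorsionOrder K ^ 2 / (2 * Real.pi) * twistedMixedMoment N (2 * (k : ℤ)) χ m
        = mrMain K N k m := by
    intro m hm hmD
    exact h D hD K h2 hK χ hζ N hN hχN m hm hmD k hk
  rw [harmonicSum_mixed_amplified_eq χ hS hSN c]
  rw [show ((2 * (k : ℤ)) - 1) = ((2 * (k : ℤ)) - 1) from rfl]
  -- distribute the constant and substitute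
  set C := Real.sqrt D * halfTorsionOrder K ^ 2 / (2 * Real.pi) with hC
  rw [mul_add, mul_add, Finset.mul_sum, Finset.mul_sum]
  congr 1
  congr 1
  · refine Finset.sum_congr rfl fun ℓ hℓ => ?_
    rw [Finset.mul_sum]
    refine Finset.sum_congr rfl fun ℓ' hℓ' => ?_
    have hℓ'S : ℓ' ∈ S := (Finset.mem_erase.1 hℓ').2
    have hm : 1 ≤ ℓ * ℓ' := Nat.one_le_iff_ne_zero.mpr
      (Nat.mul_ne_zero (hS ℓ hℓ).ne_zero (hS ℓ' hℓ'S).ne_zero)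
    rw [← hMR (ℓ * ℓ') hm (hbig ℓ hℓ ℓ' hℓ'S)]
    ring
  · refine Finset.sum_congr rfl fun ℓ hℓ => ?_
    have hm : 1 ≤ ℓ ^ 2 := Nat.one_le_iff_ne_zero.mpr (pow_ne_zero 2 (hS ℓ hℓ).ne_zero)
    have hlt : ℓ ^ 2 * D < N := by rw [sq]; exact hbig ℓ hℓ ℓ hℓ
    rw [← hMR (ℓ ^ 2) hm hlt]
    ring
  · have hlt : 1 * D < N := by rw [one_mul]; exact hDN
    rw [← hMR 1 le_rfl hlt]
    ring

/-- **PURITY OF THE AMPLIFIED MIXED MOMENT** (famE-08 at prime inert levels, prime-supported amplifiers).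
Under the hypotheses of `amplified_mixedMoment_eq_of_corollary1`:
`√D u²/(2π) · Σʰ ω_f re(L(½,f)L(½,f⊗χ_{−D})) A_f² = h · ampLinear K N k S c + h² · ampQuadratic N k S c`,
the two coefficients being explicit arithmetic forms in `(S, c)` with NO `L`-data: by the class-number
formula `h = u√D L(1,χ)/π` the amplified moment is `L(1,χ)·(…) + L(1,χ)²·(…)` — «purity», no `L'(1,χ)`
term, exactly as for (7.4). [cite: IwaniecConversations2006, §7 p. 96 («purity»)] -/
theorem amplified_mixedMoment_pure_of_corollary1 (h : michelRamakrishnan2012_corollary1)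
    {D : ℕ} [NeZero D] (hD : Odd D)
    {K : Type} [Field K] [NumberField K] (h2 : Module.finrank ℚ K = 2)
    (hK : NumberField.discr K = -(D : ℤ))
    (χ : DirichletCharacter ℂ D)
    (hζ : ∀ s : ℝ, 1 < s → NumberField.dedekindZeta K s = riemannZeta s * LSeries (fun n => χ n) s)
    {N : ℕ} [NeZero N] (hN : N.Prime) (hχN : χ N = -1) (hDN : D < N) {k : ℕ} (hk : 1 ≤ k)
    {S : Finset ℕ} (hS : ∀ ℓ ∈ S, ℓ.Prime) (hbig : ∀ ℓ ∈ S, ∀ ℓ' ∈ S, ℓ * ℓ' * D < N)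
    (c : ℕ → ℝ) :
    Real.sqrt D * halfTorsionOrder K ^ 2 / (2 * Real.pi) *
        harmonicSum N (2 * (k : ℤ))
          (fun f => (centralValue f * twistedCentralValue f χ).re * primeAmplifier S c f ^ 2)
      = classNumber K * ampLinear K k S c + (classNumber K : ℝ) ^ 2 * ampQuadratic N k S c := by
  rw [amplified_mixedMoment_eq_of_corollary1 h hD h2 hK χ hζ hN hχN hDN hk hS hbig c]
  set hh : ℝ := (classNumber K : ℝ) with hhh
  have hX : (∑ ℓ ∈ S, ∑ ℓ' ∈ S.erase ℓ, c ℓ * c ℓ' * mrMain K N k (ℓ * ℓ')) =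
      hh * (∑ ℓ ∈ S, ∑ ℓ' ∈ S.erase ℓ, c ℓ * c ℓ' * mrLin K k (ℓ * ℓ')) +
        hh ^ 2 * (∑ ℓ ∈ S, ∑ ℓ' ∈ S.erase ℓ, c ℓ * c ℓ' * mrQuad N k (ℓ * ℓ')) := by
    have hin : ∀ ℓ ∈ S, (∑ ℓ' ∈ S.erase ℓ, c ℓ * c ℓ' * mrMain K N k (ℓ * ℓ')) =
        hh * (∑ ℓ' ∈ S.erase ℓ, c ℓ * c ℓ' * mrLin K k (ℓ * ℓ')) +
          hh ^ 2 * (∑ ℓ' ∈ S.erase ℓ, c ℓ * c ℓ' * mrQuad N k (ℓ * ℓ')) := by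
      intro ℓ _
      simp only [mrMain_eq]
      exact sum_mul_split _ _ _ _ hh
    rw [Finset.sum_congr rfl hin, Finset.sum_add_distrib, ← Finset.mul_sum, ← Finset.mul_sum]
  have hY : (∑ ℓ ∈ S, c ℓ ^ 2 * mrMain K N k (ℓ ^ 2)) =
      hh * (∑ ℓ ∈ S, c ℓ ^ 2 * mrLin K k (ℓ ^ 2)) +
        hh ^ 2 * (∑ ℓ ∈ S, c ℓ ^ 2 * mrQuad N k (ℓ ^ 2)) := by
    simp only [mrMain_eq]
    exact sum_mul_split _ _ _ _ hh
  have hZ : (∑ ℓ ∈ S, c ℓ ^ 2 * (ℓ : ℝ) ^ ((2 * (k : ℤ)) - 1)) * mrMain K N k 1 =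
      hh * ((∑ ℓ ∈ S, c ℓ ^ 2 * (ℓ : ℝ) ^ ((2 * (k : ℤ)) - 1)) * mrLin K k 1) +
        hh ^ 2 * ((∑ ℓ ∈ S, c ℓ ^ 2 * (ℓ : ℝ) ^ ((2 * (k : ℤ)) - 1)) * mrQuad N k 1) := by
    rw [mrMain_eq]
    ring
  rw [hX, hY, hZ]
  unfold ampLinear ampQuadratic
  ring

end Purity

end Literature.NumberTheory.LFunctions

end
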